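import Literature.Geometry.Riemannian.HeatKernelBootstrapBallAux
import Literature.Geometry.Riemannian.LowerVolumeBoundHCenter
import Literature.Geometry.Riemannian.HeatKernelForwardMass
import Literature.Geometry.Riemannian.KernelNashEntropyMonotone
import HarnessLib

/-!
# The ball part of Bamler's heat kernel bootstrap (Bamler 2020a, §7.2, (7.10)–(7.12))

R. Bamler, *Entropy and heat kernel bounds on a Ricci flow background*, arXiv:2008.07093 (2020a),
§7.2, proof of Thm. 7.1 (the upper heat kernel bound `K(x,t;y,s) ≤ C τ^{-n/2} e^{−𝒩*}`),
displays (7.10)–(7.12): with `u = K(·,·;y,s)`, `t = s + τ`, `t₁ = s + (1 − ρ²)τ` and an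
`H_n`-centre `(z₁, t₁)` of `(x, t)`, on the ball `B = B(z₁, t₁, √(A H_n) ρ √τ)`
"`|B|_{t₁} ≥ c exp(𝒩*) ρⁿ τ^{n/2}` (Thm. 6.2) … `|∇u|(·,t₁) ≤ C Z exp(−𝒩*) τ^{-(n+1)/2}` on
`B` … thus for `x', x'' ∈ B`, `u(x',t₁) ≤ u(x'',t₁) + C Z ρ exp(−𝒩*) τ^{-n/2}`; integrating over
`B` and using `∫ u dg_{t₁} ≤ C` ((7.3)): `u(x',t₁) ≤ |B|⁻¹ ∫_B u dg_{t₁} + C Z ρ e^{−𝒩*} τ^{-n/2}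
≤ C (ρ^{-n} + Z ρ) τ^{-n/2} exp(−𝒩*_s(x,t))`".

This file PROVES this step, with explicit constants, for a Ricci flow `hflow = (h, cov)` on
`[a, T]` of a `C^∞` family of Riemannian metrics on a closed connected manifold modelled on `ℝᵐ`
(`m ≥ 3`), the tree's heat kernel `K = hflow.heatKernelFn hh hR` (`RicciFlowHeatKernelFn.lean`)
and pointed Nash entropy `𝒩*_s(x,t) = pointedNashEntropy h (K t x) m t s`:

* `heatKernelFn_le_of_sqrt_gradSq_le_on_ball` — `u(x') ≤ e^{−R_min(t₁−s)}/V₁ + 2 r₀ sup|∇u|`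
  with `V₁` the lower volume bound of Thm. 6.2 (`riemVolume_ball_ge_of_hCenter`), the mass
  bound (7.3) (`integral_heatKernelFn_basePoint_le_exp`) and the oscillation lemma
  `abs_sub_le_mul_edist_of_sqrt_gradSq_le` (`HeatKernelBootstrapBallAux.lean`);
* `heatKernelFn_le_on_ball_of_forall_gradSq_le` — the display above: from the gradient bound
  `|∇u|²(w) ≤ C_g² Z₂² τ^{-(m+1)} e^{−2𝒩*_s(w,t₁)}` ((7.8)) and the entropy comparison
  `𝒩*_s(x,t) − 𝒩*_s(w,t₁) ≤ c + L d_{t₁}(z₁,w)` ((7.7)/(7.9)) as hypotheses, for `x' ∈ B`,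
  `u(x') ≤ (2e^Λ(4π)^{-m/2}e^{-m/2}e^{2√(m+Λ)} ρ^{-m} + 2√(AH_m) e^{c+3L√(AH_m)ρ√τ} C_g ρ Z₂)
  τ^{-m/2} e^{−𝒩*_s(x,t)}`, `Λ ≥ max(0, −R_min τ)` (Prop. 5.2, `kernelNashEntropy_mono`, turns
  `𝒩_{x,t}(ρ²τ)` into `𝒩*_s(x,t)`).

Everything is proved; no definitions, no named facts. What is NOT here: the gradient bound (7.8)
and the entropy comparison (7.9) themselves, the tail part (7.13), the induction over scales and
Thm. 7.1 itself, non-compact flows.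

## References

* R. H. Bamler, *Entropy and heat kernel bounds on a Ricci flow background*, arXiv:2008.07093
  (2020), §7.2, proof of Thm. 7.1, (7.3), (7.10)–(7.12); §6.1 Thm. 6.2; §5.1 Prop. 5.2.
  [Bamler2020Entropy]
-/

noncomputable section

open Set Filter Function MeasureTheory Measure
open scoped Manifold ContDiff Topology ENNReal NNReal

namespace Literature.Geometry.Riemannian

open Lorentzian Lorentzian.PseudoRiemannianMetric

section Ball

variable {m : ℕ} {M : Type*} [TopologicalSpace M] [ChartedSpace (EuclideanSpace ℝ (Fin m)) M]
  [IsManifold 𝓘(ℝ, EuclideanSpace ℝ (Fin m)) ∞ M] [T2Space M] [CompactSpace M]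
  [SecondCountableTopology M] [MeasurableSpace M] [BorelSpace M] [ConnectedSpace M]
  {h : ℝ → PseudoRiemannianMetric 𝓘(ℝ, EuclideanSpace ℝ (Fin m)) ∞ (EuclideanSpace ℝ (Fin m))
    (TangentSpace 𝓘(ℝ, EuclideanSpace ℝ (Fin m)) : M → Type _)}
  {cov : ℝ → CovariantDerivative 𝓘(ℝ, EuclideanSpace ℝ (Fin m)) (EuclideanSpace ℝ (Fin m))
    (TangentSpace 𝓘(ℝ, EuclideanSpace ℝ (Fin m)) : M → Type _)}
  {a T : ℝ}

/-- `VB (u' − osc) ≤ mass`, `0 < V₁ ≤ VB`, `0 ≤ mass` give `u' ≤ mass / V₁ + osc`. [folklore] -/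
private theorem aux_le_div_add {u' osc VB mass V₁ : ℝ} (h : VB * (u' - osc) ≤ mass)
    (hV : V₁ ≤ VB) (hV₁ : 0 < V₁) (hmass : 0 ≤ mass) : u' ≤ mass / V₁ + osc := by
  have hVB : 0 < VB := hV₁.trans_le hV
  have h1 : u' - osc ≤ mass / VB := by rw [le_div_iff₀ hVB]; linarith
  have h2 : mass / VB ≤ mass / V₁ := div_le_div_of_nonneg_left hmass hV₁ hV
  linarith

/-- **Ball average plus oscillation** (Bamler 2020a, §7.2, proof of Thm. 7.1, (7.10)–(7.12), in
kernel form). Let `(h, cov)` be a Ricci flow on `[a, T]` of a smooth family of Riemannian metrics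
on a closed connected `M` modelled on `ℝᵐ`, `m ≥ 3`, `a < s < t₁ < t ≤ T`, `R ≥ R_min` on
`M × [s, t₁]`, `u = K(·,t₁;y,s)`, and let `z₁` be an `H_m`-centre of `(x, t)` at time `t₁`
(`∫ d_{t₁}(z₁,·)² dν_{x,t;t₁} ≤ H_m (t − t₁)`, `H_m = (m−1)π²/2 + 4`). If `r₀ ≥ √(2 H_m (t − t₁))`
and `|∇u|_{t₁} ≤ K` on `{d_{t₁}(z₁,·) ≤ 3r₀}`, then for every `x'` with `d_{t₁}(z₁, x') < r₀`

  `u(x') ≤ e^{−R_min (t₁−s)} / V₁ + 2 r₀ K`,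
  `V₁ = ½ (4π(t−t₁))^{m/2} e^{m/2} e^{−2√(m − 2 R_min (t−t₁))} e^{𝒩_{x,t}(t − t₁)}`:

`u(x') ≤ u(x'') + 2 r₀ K` on the ball `B = {d_{t₁}(z₁,·) < r₀}` (oscillation,
`abs_sub_le_mul_edist_of_sqrt_gradSq_le`), integrate `dg_{t₁}(x'')` over `B`, and use the mass
bound `∫ u dg_{t₁} ≤ e^{−R_min(t₁−s)}` ((7.3), `integral_heatKernelFn_basePoint_le_exp`) and the
lower volume bound `|B|_{t₁} ≥ V₁` (Thm. 6.2, `riemVolume_ball_ge_of_hCenter`).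
[cite: Bamler2020Entropy, §7.2, proof of Thm. 7.1, (7.10)–(7.12)] -/
theorem heatKernelFn_le_of_sqrt_gradSq_le_on_ball (hflow : IsRicciFlow h cov (Icc a T))
    (hh : IsContMDiffFamilyOn ∞ h univ) (hR : ∀ r, (h r).IsRiemannian) (hm : 3 ≤ m)
    {s t₁ t : ℝ} (has : a < s) (hst₁ : s < t₁) (ht₁t : t₁ < t) (htT : t ≤ T) {Rmin : ℝ}
    (hRmin : ∀ r ∈ Icc s t₁, ∀ z : M, Rmin ≤ (h r).scalarCurvatureWith (cov r) z) (y x z₁ : M)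
    (hz : ∫⁻ w, (h t₁).edist (hR t₁) z₁ w ^ 2 ∂(heatKernelMeasure hh hR t x t₁) ≤
      ENNReal.ofReal ((((m : ℝ) - 1) * Real.pi ^ 2 / 2 + 4) * (t - t₁)))
    {r₀ K : ℝ} (hr₀ : Real.sqrt (2 * ((((m : ℝ) - 1) * Real.pi ^ 2 / 2 + 4) * (t - t₁))) ≤ r₀)
    (hK : 0 ≤ K)
    (hgrad : ∀ w, (h t₁).edist (hR t₁) z₁ w ≤ ENNReal.ofReal (3 * r₀) →
      Real.sqrt ((h t₁).gradSq (fun v ↦ hflow.heatKernelFn hh hR t₁ v (y, s)) w) ≤ K)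
    (x' : M) (hx' : (h t₁).edist (hR t₁) z₁ x' < ENNReal.ofReal r₀) :
    hflow.heatKernelFn hh hR t₁ x' (y, s) ≤
      Real.exp (-Rmin * (t₁ - s)) / (1 / 2 * (4 * Real.pi * (t - t₁)) ^ ((m : ℝ) / 2) *
          Real.exp ((m : ℝ) / 2) * Real.exp (-2 * Real.sqrt ((m : ℝ) - 2 * Rmin * (t - t₁))) *
          Real.exp (pointedNashEntropy h (fun r y ↦ hflow.heatKernelFn hh hR t x (y, r)) m t t₁)) +
        K * (2 * r₀) := by
  have ht₁T : t₁ < T := ht₁t.trans_le htT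
  have ht₁' : t₁ ∈ Ioc a T := ⟨has.trans hst₁, ht₁T.le⟩
  have hs' : s ∈ Ioo a t₁ := ⟨has, hst₁⟩
  -- the slice `u = K(·,t₁;y,s)`: positive, `C^∞`, integrable
  have hupos : ∀ w, 0 < hflow.heatKernelFn hh hR t₁ w (y, s) := fun w ↦
    hflow.heatKernelFn_pos hh hR ht₁' w ⟨mem_univ _, hs'⟩
  have hus : ContMDiff 𝓘(ℝ, EuclideanSpace ℝ (Fin m)) 𝓘(ℝ, ℝ) ∞
      fun v ↦ hflow.heatKernelFn hh hR t₁ v (y, s) := by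
    have hKb := hflow.contMDiffOn_heatKernelFn_basePoint hh hR (s := s) ⟨has, hst₁.trans ht₁T⟩ y
    have hι : ContMDiff 𝓘(ℝ, EuclideanSpace ℝ (Fin m))
        ((𝓘(ℝ, EuclideanSpace ℝ (Fin m))).prod 𝓘(ℝ, ℝ)) ∞ fun v : M ↦ (v, t₁) :=
      contMDiff_id.prodMk contMDiff_const
    exact hKb.comp_contMDiff hι fun v ↦ ⟨mem_univ _, hst₁, ht₁T⟩
  haveI : IsFiniteMeasure (h t₁).riemVolume := ⟨(h t₁).riemVolume_univ_lt_top⟩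
  have hui : Integrable (fun w ↦ hflow.heatKernelFn hh hR t₁ w (y, s)) (h t₁).riemVolume :=
    hus.continuous.integrable_of_hasCompactSupport (HasCompactSupport.of_compactSpace _)
  -- oscillation over the ball `B = {d_{t₁}(z₁, ·) < r₀}`
  have hosc : ∀ x'' ∈ {w | (h t₁).edist (hR t₁) z₁ w < ENNReal.ofReal r₀},
      hflow.heatKernelFn hh hR t₁ x' (y, s) - K * (2 * r₀) ≤
        hflow.heatKernelFn hh hR t₁ x'' (y, s) := by
    intro x'' hx''
    obtain ⟨h1, h2⟩ :=
      abs_sub_le_mul_edist_of_sqrt_gradSq_le (h t₁) (hR t₁) hus z₁ hK hgrad hx' hx''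
    have h3 := (le_abs_self _).trans (h1.trans (mul_le_mul_of_nonneg_left h2.le hK))
    linarith
  -- mass bound (7.3)
  have hmass : ∫ w, hflow.heatKernelFn hh hR t₁ w (y, s) ∂(h t₁).riemVolume ≤
      Real.exp (-Rmin * (t₁ - s)) :=
    integral_heatKernelFn_basePoint_le_exp hflow hh hR has hst₁ ht₁T.le hRmin y
  -- lower volume bound (Thm. 6.2) for the smaller ball `{d_{t₁}(z₁, ·) < √(2 H_m (t − t₁))} ⊆ B`
  have hBo : IsOpen {w | (h t₁).edist (hR t₁) z₁ w < ENNReal.ofReal r₀} :=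
    isOpen_setOf_edist_lt (hR t₁) z₁ _
  have hB₂B : {w | (h t₁).edist (hR t₁) z₁ w <
      ENNReal.ofReal (Real.sqrt (2 * ((((m : ℝ) - 1) * Real.pi ^ 2 / 2 + 4) * (t - t₁))))} ⊆
      {w | (h t₁).edist (hR t₁) z₁ w < ENNReal.ofReal r₀} :=
    fun w hw ↦ lt_of_lt_of_le hw (ENNReal.ofReal_le_ofReal hr₀)
  have hvol := riemVolume_ball_ge_of_hCenter hflow hh hR hm (has.trans hst₁) ht₁t htT x z₁ hz
    fun w ↦ hRmin t₁ ⟨hst₁.le, le_rfl⟩ w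
  have hV₁ : 1 / 2 * (4 * Real.pi * (t - t₁)) ^ ((m : ℝ) / 2) * Real.exp ((m : ℝ) / 2) *
      Real.exp (-2 * Real.sqrt ((m : ℝ) - 2 * Rmin * (t - t₁))) *
      Real.exp (pointedNashEntropy h (fun r y ↦ hflow.heatKernelFn hh hR t x (y, r)) m t t₁) ≤
      ((h t₁).riemVolume {w | (h t₁).edist (hR t₁) z₁ w < ENNReal.ofReal r₀}).toReal := by
    rw [← ENNReal.ofReal_le_iff_le_toReal (measure_ne_top _ _)]
    exact hvol.trans (measure_mono hB₂B)
  -- average over `B`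
  have havg : ((h t₁).riemVolume {w | (h t₁).edist (hR t₁) z₁ w < ENNReal.ofReal r₀}).toReal *
      (hflow.heatKernelFn hh hR t₁ x' (y, s) - K * (2 * r₀)) ≤ Real.exp (-Rmin * (t₁ - s)) := by
    have h1 := setIntegral_mono_on (integrable_const _).integrableOn hui.integrableOn
      hBo.measurableSet hosc
    have h2 := setIntegral_le_integral (s := {w | (h t₁).edist (hR t₁) z₁ w < ENNReal.ofReal r₀})
      hui (Eventually.of_forall fun w ↦ (hupos w).le)
    rw [setIntegral_const, smul_eq_mul, measureReal_def] at h1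
    exact (h1.trans h2).trans hmass
  exact aux_le_div_add havg hV₁ (by positivity) (Real.exp_pos _).le

/-- `t₁ = s + (1 − ρ²)τ` lies strictly between `s` and `t = s + τ`. [folklore] -/
private theorem aux_times {s τ ρ : ℝ} (hτ : 0 < τ) (hρ : 0 < ρ) (hρ2 : ρ ≤ 1 / 2) :
    s < s + (1 - ρ ^ 2) * τ ∧ s + (1 - ρ ^ 2) * τ < s + τ := by
  have hρsq : ρ ^ 2 ≤ 1 / 4 := by nlinarith
  have h1 : 0 < (1 - ρ ^ 2) * τ := mul_pos (by linarith) hτ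
  have h2 : 0 < ρ ^ 2 * τ := by positivity
  constructor <;> nlinarith

/-- `−R_min(1 − ρ²)τ ≤ Λ` and `m − 2R_min ρ²τ ≤ m + Λ` if `Λ ≥ max(0, −R_min τ)`, `ρ ≤ ½`.
[folklore] -/
private theorem aux_curv {n Rmin Λ τ ρ : ℝ} (hρ : 0 < ρ) (hρ2 : ρ ≤ 1 / 2) (hΛ : 0 ≤ Λ)
    (hRΛ : -Rmin * τ ≤ Λ) :
    -Rmin * ((1 - ρ ^ 2) * τ) ≤ Λ ∧ n - 2 * Rmin * (ρ ^ 2 * τ) ≤ n + Λ := by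
  have hρsq : ρ ^ 2 ≤ 1 / 4 := by nlinarith
  have h1 : 0 ≤ (1 - ρ ^ 2) * (Λ + Rmin * τ) := mul_nonneg (by linarith) (by linarith)
  have h2 : 0 ≤ ρ ^ 2 * Λ := by positivity
  have h3 : 0 ≤ Λ * (1 / 4 - ρ ^ 2) := mul_nonneg hΛ (by linarith)
  have h4 : 0 ≤ ρ ^ 2 * (Λ + Rmin * τ) := mul_nonneg (by positivity) (by linarith)
  constructor <;> nlinarith [h1, h2, h3, h4]

/-- `√(2 H ρ²τ) ≤ √(A H) ρ √τ` for `A ≥ 2`. [folklore] -/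
private theorem aux_sqrt_le {A H ρ τ : ℝ} (hA : 2 ≤ A) (hH : 0 < H) (hρ : 0 < ρ) (hτ : 0 < τ) :
    Real.sqrt (2 * (H * (ρ ^ 2 * τ))) ≤ Real.sqrt (A * H) * ρ * Real.sqrt τ := by
  have hA0 : 0 < A := by linarith
  have hr : 0 ≤ Real.sqrt (A * H) * ρ * Real.sqrt τ := by positivity
  rw [← Real.sqrt_sq hr]
  apply Real.sqrt_le_sqrt
  rw [mul_pow, mul_pow, Real.sq_sqrt (by positivity), Real.sq_sqrt hτ.le]
  have hp : 0 ≤ (A - 2) * (H * (ρ ^ 2 * τ)) := mul_nonneg (by linarith) (by positivity)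
  nlinarith [hp]

/-- `(4πρ²τ)^{m/2} = (4π)^{m/2} ρ^m τ^{m/2}`. [folklore] -/
private theorem aux_rpow_eq {ρ τ : ℝ} (hρ : 0 < ρ) (hτ : 0 < τ) (k : ℕ) :
    (4 * Real.pi * (ρ ^ 2 * τ)) ^ ((k : ℝ) / 2) =
      (4 * Real.pi) ^ ((k : ℝ) / 2) * ρ ^ (k : ℝ) * τ ^ ((k : ℝ) / 2) := by
  rw [← mul_assoc, Real.mul_rpow (by positivity) hτ.le,
    Real.mul_rpow (by positivity) (by positivity)]
  congr 2
  rw [← Real.rpow_natCast ρ 2, ← Real.rpow_mul hρ.le]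
  congr 1
  push_cast
  ring

/-- `e^Λ / (½ (4π)^{m/2} ρ^m τ^{m/2} e^{m/2} e^{−2√(m+Λ)} e^N)` in product form. [folklore] -/
private theorem aux_exp_div_eq {Λ ρ τ N : ℝ} (hρ : 0 < ρ) (hτ : 0 < τ) (k : ℕ) :
    Real.exp Λ / (1 / 2 * ((4 * Real.pi) ^ ((k : ℝ) / 2) * ρ ^ (k : ℝ) * τ ^ ((k : ℝ) / 2)) *
        Real.exp ((k : ℝ) / 2) * Real.exp (-2 * Real.sqrt ((k : ℝ) + Λ)) * Real.exp N) =
      2 * Real.exp Λ * (4 * Real.pi) ^ (-(k : ℝ) / 2) * Real.exp (-(k : ℝ) / 2) *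
        Real.exp (2 * Real.sqrt ((k : ℝ) + Λ)) * ρ ^ (-(k : ℝ)) * τ ^ (-(k : ℝ) / 2) *
        Real.exp (-N) := by
  simp only [neg_div, Real.rpow_neg (by positivity : (0 : ℝ) ≤ 4 * Real.pi),
    Real.rpow_neg hτ.le, Real.rpow_neg hρ.le, Real.exp_neg, neg_mul]
  field_simp

/-- `√(τ^{−(m+1)}) √τ = τ^{−m/2}`. [folklore] -/
private theorem aux_sqrt_rpow_mul_sqrt {τ : ℝ} (hτ : 0 < τ) (k : ℕ) :
    Real.sqrt (τ ^ (-((k : ℝ) + 1))) * Real.sqrt τ = τ ^ (-(k : ℝ) / 2) := by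
  rw [Real.sqrt_eq_rpow, Real.sqrt_eq_rpow, ← Real.rpow_mul hτ.le, ← Real.rpow_add hτ]
  congr 1
  ring

/-- `√(C_g² Z₂² τ^{−(m+1)} e^{−2N}) = C_g Z₂ √(τ^{−(m+1)}) e^{−N}`. [folklore] -/
private theorem aux_sqrt_gradBound {Cg Z₂ τ N : ℝ} (hCg : 0 ≤ Cg) (hZ : 0 ≤ Z₂) (hτ : 0 < τ)
    (k : ℕ) :
    Real.sqrt (Cg ^ 2 * Z₂ ^ 2 * τ ^ (-((k : ℝ) + 1)) * Real.exp (-2 * N)) =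
      Cg * Z₂ * Real.sqrt (τ ^ (-((k : ℝ) + 1))) * Real.exp (-N) := by
  have e : Cg ^ 2 * Z₂ ^ 2 * τ ^ (-((k : ℝ) + 1)) * Real.exp (-2 * N) =
      (Cg * Z₂ * Real.sqrt (τ ^ (-((k : ℝ) + 1))) * Real.exp (-N)) ^ 2 := by
    rw [mul_pow, mul_pow, mul_pow, Real.sq_sqrt (Real.rpow_nonneg hτ.le _),
      show Real.exp (-2 * N) = Real.exp (-N) ^ 2 by rw [sq, ← Real.exp_add]; congr 1; ring]
  rw [e, Real.sqrt_sq (by positivity)]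

/-- **Bamler 2020a, §7.2, proof of Thm. 7.1, (7.10)–(7.12): the ball part of the bootstrap.**
Let `(h, cov)` be a Ricci flow on `[a, T]` of a smooth family of Riemannian metrics on a closed
connected `M` modelled on `ℝᵐ`, `m ≥ 3`, `a < s`, `t = s + τ ≤ T`, `0 < ρ ≤ ½`,
`t₁ = s + (1 − ρ²)τ`, `R ≥ R_min` on `M × [s, t]`, `Λ ≥ max(0, −R_min τ)`, `u = K(·,t₁;y,s)`,
`H_m = (m−1)π²/2 + 4`, `z₁` an `H_m`-centre of `(x, t)` at time `t₁`, `A ≥ 2`. Assume the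
entropy comparison `𝒩*_s(x,t) − 𝒩*_s(w,t₁) ≤ c + L d_{t₁}(z₁,w)` ((7.7)/(7.9)) and the
gradient bound `|∇u|²_{t₁}(w) ≤ C_g² Z₂² τ^{-(m+1)} e^{−2𝒩*_s(w,t₁)}` ((7.8)) for all `w`. Then
for every `x'` with `d_{t₁}(z₁, x') < √(A H_m) ρ √τ`,

  `u(x') ≤ (2 e^Λ (4π)^{-m/2} e^{-m/2} e^{2√(m+Λ)} ρ^{-m}`
  `        + 2√(A H_m) e^{c + 3L√(A H_m)ρ√τ} C_g ρ Z₂) τ^{-m/2} e^{−𝒩*_s(x,t)}`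

(Bamler: "`u(x',t₁) ≤ |B|⁻¹∫_B u dg_{t₁} + C Z e^{−𝒩*} ρ ≤ C(Cρ^{-n} + Zρ) exp(−𝒩*_0(x,1))`";
`heatKernelFn_le_of_sqrt_gradSq_le_on_ball` with `|∇u| ≤ C_g Z₂ τ^{-(m+1)/2} e^{−𝒩*_s(x,t)}
e^{c+3Lr₀}` on `{d_{t₁}(z₁,·) ≤ 3r₀}`, `∫u ≤ e^{−R_min(t₁−s)} ≤ e^Λ`, and
`V₁ ≥ ½(4π)^{m/2}ρ^m τ^{m/2} e^{m/2} e^{−2√(m+Λ)} e^{𝒩*_s(x,t)}` by Prop. 5.2).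
[cite: Bamler2020Entropy, §7.2, proof of Thm. 7.1, (7.10)–(7.12)] -/
theorem heatKernelFn_le_on_ball_of_forall_gradSq_le (hflow : IsRicciFlow h cov (Icc a T))
    (hh : IsContMDiffFamilyOn ∞ h univ) (hR : ∀ r, (h r).IsRiemannian) (hm : 3 ≤ m) {s τ ρ : ℝ}
    (has : a < s) (hτ : 0 < τ) (hsT : s + τ ≤ T) (hρ : 0 < ρ) (hρ2 : ρ ≤ 1 / 2) {Rmin Λ : ℝ}
    (hRmin : ∀ r ∈ Icc s (s + τ), ∀ z : M, Rmin ≤ (h r).scalarCurvatureWith (cov r) z)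
    (hΛ : 0 ≤ Λ) (hRΛ : -Rmin * τ ≤ Λ) (y x z₁ : M) {A Z₂ Cg L c : ℝ} (hA : 2 ≤ A)
    (hZ : 0 ≤ Z₂) (hCg : 0 ≤ Cg) (hL : 0 ≤ L) (_hc : 0 ≤ c)
    (hz : ∫⁻ w, (h (s + (1 - ρ ^ 2) * τ)).edist (hR (s + (1 - ρ ^ 2) * τ)) z₁ w ^ 2
        ∂(heatKernelMeasure hh hR (s + τ) x (s + (1 - ρ ^ 2) * τ)) ≤
      ENNReal.ofReal ((((m : ℝ) - 1) * Real.pi ^ 2 / 2 + 4) * (s + τ - (s + (1 - ρ ^ 2) * τ))))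
    (hEC : ∀ w : M, pointedNashEntropy h (fun r v ↦ hflow.heatKernelFn hh hR (s + τ) x (v, r)) m
          (s + τ) s -
        pointedNashEntropy h (fun r v ↦ hflow.heatKernelFn hh hR (s + (1 - ρ ^ 2) * τ) w (v, r))
          m (s + (1 - ρ ^ 2) * τ) s ≤
      c + L * ((h (s + (1 - ρ ^ 2) * τ)).edist (hR (s + (1 - ρ ^ 2) * τ)) z₁ w).toReal)
    (hG : ∀ w : M, (h (s + (1 - ρ ^ 2) * τ)).gradSq
        (fun v ↦ hflow.heatKernelFn hh hR (s + (1 - ρ ^ 2) * τ) v (y, s)) w ≤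
      Cg ^ 2 * Z₂ ^ 2 * τ ^ (-((m : ℝ) + 1)) * Real.exp (-2 * pointedNashEntropy h
        (fun r v ↦ hflow.heatKernelFn hh hR (s + (1 - ρ ^ 2) * τ) w (v, r)) m
        (s + (1 - ρ ^ 2) * τ) s))
    (x' : M) (hx' : (h (s + (1 - ρ ^ 2) * τ)).edist (hR (s + (1 - ρ ^ 2) * τ)) z₁ x' <
      ENNReal.ofReal (Real.sqrt (A * (((m : ℝ) - 1) * Real.pi ^ 2 / 2 + 4)) * ρ * Real.sqrt τ)) :
    hflow.heatKernelFn hh hR (s + (1 - ρ ^ 2) * τ) x' (y, s) ≤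
      (2 * Real.exp Λ * (4 * Real.pi) ^ (-(m : ℝ) / 2) * Real.exp (-(m : ℝ) / 2) *
            Real.exp (2 * Real.sqrt ((m : ℝ) + Λ)) * ρ ^ (-(m : ℝ)) +
          2 * Real.sqrt (A * (((m : ℝ) - 1) * Real.pi ^ 2 / 2 + 4)) *
            Real.exp (c + 3 * L * (Real.sqrt (A * (((m : ℝ) - 1) * Real.pi ^ 2 / 2 + 4)) * ρ *
              Real.sqrt τ)) * Cg * ρ * Z₂) *
        τ ^ (-(m : ℝ) / 2) * Real.exp (-(pointedNashEntropy h
          (fun r v ↦ hflow.heatKernelFn hh hR (s + τ) x (v, r)) m (s + τ) s)) := by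
  -- elementary facts (with `t₁ = s + (1 − ρ²)τ`, `t = s + τ`, `t − t₁ = ρ²τ`)
  obtain ⟨ht₁s, ht₁t⟩ := aux_times (s := s) hτ hρ hρ2
  have hm3 : (3 : ℝ) ≤ m := by exact_mod_cast hm
  have hHm0 : (0 : ℝ) < ((m : ℝ) - 1) * Real.pi ^ 2 / 2 + 4 := by
    have h1 : (0 : ℝ) ≤ ((m : ℝ) - 1) * Real.pi ^ 2 / 2 :=
      div_nonneg (mul_nonneg (by linarith) (sq_nonneg _)) zero_le_two
    linarith
  have e1 : s + (1 - ρ ^ 2) * τ - s = (1 - ρ ^ 2) * τ := by ring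
  have e2 : s + τ - (s + (1 - ρ ^ 2) * τ) = ρ ^ 2 * τ := by ring
  have hr₀le : Real.sqrt (2 * ((((m : ℝ) - 1) * Real.pi ^ 2 / 2 + 4) *
      (s + τ - (s + (1 - ρ ^ 2) * τ)))) ≤
      Real.sqrt (A * (((m : ℝ) - 1) * Real.pi ^ 2 / 2 + 4)) * ρ * Real.sqrt τ := by
    rw [e2]; exact aux_sqrt_le hA hHm0 hρ hτ
  obtain ⟨hc1, hc2⟩ := aux_curv (n := (m : ℝ)) (Rmin := Rmin) hρ hρ2 hΛ hRΛ
  have hmassΛ : Real.exp (-Rmin * (s + (1 - ρ ^ 2) * τ - s)) ≤ Real.exp Λ := by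
    rw [e1]; exact Real.exp_le_exp.2 hc1
  have hcurv : (m : ℝ) - 2 * Rmin * (s + τ - (s + (1 - ρ ^ 2) * τ)) ≤ m + Λ := by
    rw [e2]; exact hc2
  have hpow : (4 * Real.pi * (s + τ - (s + (1 - ρ ^ 2) * τ))) ^ ((m : ℝ) / 2) =
      (4 * Real.pi) ^ ((m : ℝ) / 2) * ρ ^ (m : ℝ) * τ ^ ((m : ℝ) / 2) := by
    rw [e2]; exact aux_rpow_eq hρ hτ m
  -- abstract `t₁`, `𝒩*_s(x,t)` and `r₀`
  generalize ht₁ : s + (1 - ρ ^ 2) * τ = t₁ at hz hEC hG hx' ht₁s ht₁t hr₀le hmassΛ hcurv hpow ⊢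
  generalize hNx : pointedNashEntropy h (fun r v ↦ hflow.heatKernelFn hh hR (s + τ) x (v, r)) m
    (s + τ) s = Nx at hEC ⊢
  generalize hr₀ : Real.sqrt (A * (((m : ℝ) - 1) * Real.pi ^ 2 / 2 + 4)) * ρ * Real.sqrt τ = r₀
    at hx' hr₀le ⊢
  have hr₀0 : 0 < r₀ := ENNReal.ofReal_pos.1 (lt_of_le_of_lt (by positivity) hx')
  -- Step 1: the gradient bound `|∇u| ≤ K₁` on `{d_{t₁}(z₁, ·) ≤ 3 r₀}`
  obtain ⟨K₁, hK₁⟩ : ∃ K₁ : ℝ, K₁ = Cg * Z₂ * Real.sqrt (τ ^ (-((m : ℝ) + 1))) *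
      Real.exp (-Nx) * Real.exp (c + 3 * L * r₀) := ⟨_, rfl⟩
  have hK₁0 : 0 ≤ K₁ := by rw [hK₁]; positivity
  have hgradK : ∀ w, (h t₁).edist (hR t₁) z₁ w ≤ ENNReal.ofReal (3 * r₀) →
      Real.sqrt ((h t₁).gradSq (fun v ↦ hflow.heatKernelFn hh hR t₁ v (y, s)) w) ≤ K₁ := by
    intro w hw
    have hdw : ((h t₁).edist (hR t₁) z₁ w).toReal ≤ 3 * r₀ :=
      ENNReal.toReal_le_of_le_ofReal (by positivity) hw
    have h1 := Real.sqrt_le_sqrt (hG w)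
    rw [aux_sqrt_gradBound hCg hZ hτ m] at h1
    have h2 : Real.exp (-pointedNashEntropy h
        (fun r v ↦ hflow.heatKernelFn hh hR t₁ w (v, r)) m t₁ s) ≤
        Real.exp (-Nx) * Real.exp (c + 3 * L * r₀) := by
      rw [← Real.exp_add]
      have h3 : L * ((h t₁).edist (hR t₁) z₁ w).toReal ≤ L * (3 * r₀) :=
        mul_le_mul_of_nonneg_left hdw hL
      exact Real.exp_le_exp.2 (by linarith [hEC w])
    calc _ ≤ _ := h1
      _ ≤ Cg * Z₂ * Real.sqrt (τ ^ (-((m : ℝ) + 1))) *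
          (Real.exp (-Nx) * Real.exp (c + 3 * L * r₀)) :=
          mul_le_mul_of_nonneg_left h2 (by positivity)
      _ = K₁ := by rw [hK₁]; ring
  -- Step 2: ball average + oscillation
  have hcore := heatKernelFn_le_of_sqrt_gradSq_le_on_ball hflow hh hR hm has ht₁s ht₁t hsT
    (fun r hr z ↦ hRmin r ⟨hr.1, hr.2.trans ht₁t.le⟩ z) y x z₁ hz hr₀le hK₁0 hgradK x' hx'
  -- Step 3: the constants
  have hmono : Nx ≤
      pointedNashEntropy h (fun r v ↦ hflow.heatKernelFn hh hR (s + τ) x (v, r)) m (s + τ) t₁ := by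
    rw [← hNx]; exact kernelNashEntropy_mono hflow hh hR hm has ht₁s.le ht₁t hsT x
  have hV₀V₁ : 1 / 2 * ((4 * Real.pi) ^ ((m : ℝ) / 2) * ρ ^ (m : ℝ) * τ ^ ((m : ℝ) / 2)) *
      Real.exp ((m : ℝ) / 2) * Real.exp (-2 * Real.sqrt ((m : ℝ) + Λ)) * Real.exp Nx ≤
      1 / 2 * (4 * Real.pi * (s + τ - t₁)) ^ ((m : ℝ) / 2) * Real.exp ((m : ℝ) / 2) *
        Real.exp (-2 * Real.sqrt ((m : ℝ) - 2 * Rmin * (s + τ - t₁))) *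
        Real.exp (pointedNashEntropy h (fun r v ↦ hflow.heatKernelFn hh hR (s + τ) x (v, r)) m
          (s + τ) t₁) := by
    rw [hpow]
    have hE1 : Real.exp (-2 * Real.sqrt ((m : ℝ) + Λ)) ≤
        Real.exp (-2 * Real.sqrt ((m : ℝ) - 2 * Rmin * (s + τ - t₁))) :=
      Real.exp_le_exp.2 (by linarith [Real.sqrt_le_sqrt hcurv])
    exact mul_le_mul (mul_le_mul_of_nonneg_left hE1 (by positivity)) (Real.exp_le_exp.2 hmono)
      (Real.exp_pos _).le (by positivity)
  have hV₀pos : 0 < 1 / 2 * ((4 * Real.pi) ^ ((m : ℝ) / 2) * ρ ^ (m : ℝ) * τ ^ ((m : ℝ) / 2)) *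
      Real.exp ((m : ℝ) / 2) * Real.exp (-2 * Real.sqrt ((m : ℝ) + Λ)) * Real.exp Nx := by
    positivity
  have hdiv := div_le_div₀ (Real.exp_pos Λ).le hmassΛ hV₀pos hV₀V₁
  have step := hcore.trans (add_le_add hdiv le_rfl)
  rw [aux_exp_div_eq hρ hτ m] at step
  have hB' : K₁ * (2 * r₀) = 2 * Real.sqrt (A * (((m : ℝ) - 1) * Real.pi ^ 2 / 2 + 4)) *
      Real.exp (c + 3 * L * r₀) * Cg * ρ * Z₂ * τ ^ (-(m : ℝ) / 2) * Real.exp (-Nx) := by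
    rw [hK₁, ← aux_sqrt_rpow_mul_sqrt hτ m, ← hr₀]
    ring
  rw [hB'] at step
  linarith [step]

end Ball

end Literature.Geometry.Riemannian

end
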